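import Mathlib.Data.Nat.Choose.Basic
import Mathlib.Algebra.BigOperators.Group.Finset.Basic
import Mathlib.Tactic
import Literature.NumberTheory.LFunctions.SchoenfeldPsiSmall
import HarnessLib

/-!
# ζ(5) search — kernel kit: small computable helpers for `decide +kernel` certificates

HONEST FRAMING: systematic search; no irrationality claim unless certified.

Cell `pub-zeta5` (summit KontsevichZagierPeriods, topic Zeta5Search). A LIGHT module (no kernel
computation inside) collecting the kernel-friendly evaluators that the cell's certificate files share, each
PROVED equal to its Mathlib counterpart, so that a certificate file imports this kit rather than another
(heavy) certificate file:

* `lcmRun n` — running `lcm(1,…,n)` by structural recursion; `lcmRun_eq : lcmRun n = Nat.lcmUpto n`;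
* `isIntegerB x` — Boolean integrality test on the reduced denominator of `x : ℚ`, with
  `exists_int_of_isIntegerB` / `not_exists_int_of_isIntegerB`;
* `binomF n k = n.descFactorial k / k!` (linear-time binomial) with `binomF_eq : binomF n k = n.choose k`;
* `sumUpTo f m = f 0 + ⋯ + f m` with `sumUpTo_eq`;
* `bitsum n` — the binary digit sum `s₂(n)` by structural recursion (used to state exact 2-adic orders);
* `posRatB x` — Boolean positivity test with `pos_of_posRatB`.

Pattern of use (as in `Literature.NumberTheory.LFunctions.SchoenfeldPsiSmall` and
`SymmetricFamilyCertificates.lean`): a `Bool`-valued checker by structural recursion, a soundness lemma,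
and ONE `decide +kernel` per certificate, at default heartbeats.
-/

namespace Summit.KontsevichZagierPeriods.Zeta5Search.KernelKit

open Finset

/-- Running least common multiple `lcm(1, …, n)` by structural recursion (kernel-friendly). -/
def lcmRun : ℕ → ℕ
  | 0 => 1
  | n + 1 => Nat.lcm (n + 1) (lcmRun n)

/-- `lcmRun n = Nat.lcmUpto n`. -/
theorem lcmRun_eq (n : ℕ) : lcmRun n = Nat.lcmUpto n := by
  induction n with
  | zero => simp [lcmRun, Nat.lcmUpto]
  | succ n ih =>
    rw [lcmRun, ih, Literature.NumberTheory.LFunctions.SchoenfeldBound.lcmUpto_succ]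

/-- Boolean integrality test: the reduced denominator of `x` is `1`. -/
def isIntegerB (x : ℚ) : Bool := x.den == 1

/-- A passed integrality test yields an integer equal to `x`. -/
theorem exists_int_of_isIntegerB {x : ℚ} (h : isIntegerB x = true) : ∃ z : ℤ, (z : ℚ) = x :=
  ⟨x.num, (Rat.den_eq_one_iff x).mp (by simpa [isIntegerB] using h)⟩

/-- A failed integrality test means `x` is not an integer. -/
theorem not_exists_int_of_isIntegerB {x : ℚ} (h : isIntegerB x = false) : ¬ ∃ z : ℤ, (z : ℚ) = x := by
  rintro ⟨z, rfl⟩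
  simp [isIntegerB] at h

/-- Boolean positivity test on `ℚ`. -/
def posRatB (x : ℚ) : Bool := decide (0 < x)

/-- A passed positivity test. -/
theorem pos_of_posRatB {x : ℚ} (h : posRatB x = true) : 0 < x := by
  simpa [posRatB] using h

/-- Binomial coefficient via the descending factorial (linear-time in the kernel). -/
def binomF (n k : ℕ) : ℕ := n.descFactorial k / k.factorial

/-- `binomF n k = n.choose k`. -/
theorem binomF_eq (n k : ℕ) : binomF n k = n.choose k :=
  (Nat.choose_eq_descFactorial_div_factorial n k).symm

/-- `sumUpTo f m = f 0 + f 1 + ⋯ + f m` by structural recursion. -/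
def sumUpTo (f : ℕ → ℕ) : ℕ → ℕ
  | 0 => f 0
  | m + 1 => sumUpTo f m + f (m + 1)

/-- `sumUpTo f m = ∑_{k ≤ m} f k`. -/
theorem sumUpTo_eq (f : ℕ → ℕ) (m : ℕ) : sumUpTo f m = ∑ k ∈ range (m + 1), f k := by
  induction m with
  | zero => simp [sumUpTo]
  | succ m ih => rw [sumUpTo, ih, Finset.sum_range_succ _ (m + 1)]

/-- Binary digit sum with a fuel argument (structural recursion). -/
def bitsumAux : ℕ → ℕ → ℕ
  | 0, _ => 0
  | fuel + 1, n => if n = 0 then 0 else n % 2 + bitsumAux fuel (n / 2)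

/-- The binary digit sum `s₂(n)` (`bitsum 0 = 0`, `bitsum (2m) = bitsum m`, `bitsum (2m+1) = bitsum m + 1` on
the range where the fuel `n` suffices, which is always since `n / 2 < n` for `n ≥ 1`). -/
def bitsum (n : ℕ) : ℕ := bitsumAux n n

end Summit.KontsevichZagierPeriods.Zeta5Search.KernelKit
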